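import Summits.Ventures.AbcSig.Rows.TemplateC
import Summits.Ventures.AbcSig.Levels.N722

/-!
# Venture AbcSig — ROW `XnYn19Z2Even`: `xⁿ + yⁿ = 19 z²` (`xy` even) (GENERATED by plean/leanrow.py)

HONEST FRAMING. A row of a COMPUTATION cell (`pub-abcsig`); a CONDITIONAL theorem, no claim on ABC or any summit.
Hypotheses: `BS04Package` (CITED: [BS04] Lemma 3.3 + (3.1) + Lemma 4.2), `DataComplete` at the level(s)
722 (COMPUTED, two-engine certified level files), and the listed per-orbit
exclusions `hX_…` (CITED; the row's R5 cell names the printed argument for each). Everything else is kernel-checked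
(`Rows/TemplateC.lean`, `Levels/N….lean`). Exponent range: prime `n ≥ 11`, n ∉ [19].
Row of record: census/rows/C1/C1-C19-even.md (R8-signed). Level 2·19² = 722 (engine-1 Sturm-complete, c5′ AGREE-STURM).
-/

namespace Summit.Ventures.AbcSig

/-- Row `XnYn19Z2Even`: no primitive solution of `xⁿ + yⁿ = 19 z²` with `xy` even for prime `n ≥ 11`, `n ∉ [19]`,
conditional on the named hypotheses. -/
theorem row_XnYn19Z2Even (M : NewformModel) (hP : M.BS04Package)
    (hD722 : M.DataComplete 722 level722Orbits)
    (n : ℕ) (hn : n.Prime) (hmin : 11 ≤ n) (hres : n ∉ ([19] : List ℕ))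
    
    (a b c : ℤ) (hpar : 2 ∣ a * b) : ¬ IsPrimitiveSolution 1 1 19 n a b c := by
  have h7 : 7 ≤ n := by omega
  have hC : Nat.Prime 19 := by norm_num
  have hsq : Squarefree (19 : ℕ) := (Nat.prime_iff.mp hC).squarefree
  have hnC : ¬ n ∣ 19 := by
    intro h
    simp only [List.mem_cons, List.not_mem_nil, or_false] at hres; rcases (Nat.dvd_prime hC).mp h with h1 | h1 <;> omega
  exact row_template_even 19 hsq (by decide) M hP hD722 n hn h7 hnC
    (level722_sieve n hn h7 (fun o => M.Excludes 722 o
      (fun S => S.A = 1 ∧ S.B = 1 ∧ S.C = 19 ∧ S.n = n ∧ 2 ∣ S.a * S.b)) (fun h => absurd h (by simp only [List.mem_cons, List.not_mem_nil, or_false] at hres ⊢; omega)) (fun h => absurd h (by simp only [List.mem_cons, List.not_mem_nil, or_false] at hres ⊢; omega)) (fun h => absurd h (by simp only [List.mem_cons, List.not_mem_nil, or_false] at hres ⊢; omega)) (fun h => absurd h (by simp only [List.mem_cons, List.not_mem_nil, or_false] at hres ⊢; omega)) (fun h => absurd h (by simp only [List.mem_cons, List.not_mem_nil, or_false] at hres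 ⊢; omega)) (fun h => absurd h (by simp only [List.mem_cons, List.not_mem_nil, or_false] at hres ⊢; omega)))
    a b c hpar

end Summit.Ventures.AbcSig
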